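import Summits.QuantumFields.YangMills.Theorems.BalabanUVNodesN05SubBP2DK2T8SrvGammaPrime
import Literature.MathematicalPhysics.QuantumFieldTheory.Balaban1983to89.B8Thm8SurvivingZdGF3HP2PerMapLanEGamma
import Literature.MathematicalPhysics.QuantumFieldTheory.Balaban1983to89.Node00.CarriersB8SubDPer

/-!
# EDITION «K2» (director-ym №227 (b′-2), plan YMPLAN-G87-N05-GO (R2); dag-n05-d g14, 2026-08-28): this module RE-KEYED onto PRINT's (1.3)–(1.4) CLASS AT THE PINNED BLOCK SIZE —
# the index `Node00.IdxB8SubDPer θ P` ↦ dag-n05-w1's cut `Node00.IdxB8SubDPerκ θ P Mκ Rκ = {j : IdxB8SubDPer θ P ∕∕ Admissible134 θ.L Mκ Rκ k Ω}` (one more `.1` in every accessor, the new `j.2` =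
# the print-class law), and EVERY [Balaban1985BackgroundPropagators]-type binder gains print's literal (1.3)–(1.4) «`Admissible134 θ.L Mκ Rκ i.k i.Ω`» as ONE extra member
# hypothesis right after the (1.5) law (N06 serves ONLY print's class — Q-SG1 «SURVIVES»); extra parameters `(Mκ Rκ : ℕ)`; proof terms = the «P₂D» ones token for token
# (generator `gen_k2.py` on the tree bytes).  The rest of this header is the «P₂D» header VERBATIM.
# BalabanUVNodes ∕ N05 ([Balaban1985RegularSpaces] Thm 8 p. 101, p. 77 «Ω_j ⊂ T_η»): THEOREM 8's CONJUNCT OF THE (β′-PERIODIC) δ₂-SLOT —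
# `Thm8SurvivingAt 1 λ.B₁ λ.B₂ (fun j : IdxB8SubDPerκ θ P Mκ Rκ => zdGF3HP₂Per θ.𝔸 θ.L λ.β λ.len j.1.1.1.1.1.1 P)` (dag-n05-w1's `famB8OfRecordSubBP₂DPer θ λ.β λ.len P` by `rfl`)
# on the PERIODIC (1.5)-index, FROM this seat's periodic server `B8Thm8SurvivingZdGF3HP2PerMapLanEGamma.thm8SurvivingAt_zdGF3HP₂Per_map_lanE_γ'` (CLAIM-7, exit E8a:
# the «exactly one ⇒ periodic» device on Theorem 8's Theorem-4-shaped core) at `ι := IdxB8SubDPer.toZdIdx`, `p := fun _ => P`, the three periodicity binders discharged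
# member-wise BY NAME (`j.1.periodic`, `j.1.dvd`, `j.1.isPeriodic_Λs le_rfl`) — P4 of plan PENS-217 (director-ym №217 (ii) ∕ №220 A-4 ∕ №222 A-5′)

EDITION «P₂D-PER» (dag-n05-d g14, 2026-08-28): this seat's «P₂D» module `BalabanUVNodesN05SubBP2DK2T8SrvGammaPrime` (p616586) RE-RUN on the periodic (1.5)-index
`Node00.IdxB8SubDPerκ θ P Mκ Rκ = {j : IdxB8SubDκ θ Mκ Rκ ∕∕ (0 < P ∧ θ.L ^ k ∣ P) ∧ ∀ l, IsPeriodic P (· ∈ Ω l)}` (dag-n05-w1, `Node00/CarriersB8SubDPer`) and the periodic sub-model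
`zdGF3HP₂Per` (dag-n05-c P1′, p641891): every accessor gains one `.1` (`j.1.1.1.1.1 ↦ j.1.1.1.1.1.1`, …), the ℤᵈ server ↦ the periodic server (same sockets, same constants,
three periodicity binders read off the index), everything else token for token.  The class-wide [Balaban1985BackgroundPropagators]-type binders (`SLet SLetUB SH59src
SB9srcHP` and the four Prop-5-type sockets) are UNCHANGED: they are per `ZdIdx` member and do not see the period.

Track A of `YM-PLAN.md` (cell `pub-ymgap`, HUMAN RULING D-0062), node **N05**; seat `pub-ymgap-dag-n05-d` (g14), 2026-08-28; bears on K1⁹ `stmt-QuantumFields-27364`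
(`--supports … --as helper`, count-neutral).

WHAT IS PROVED (composition BY NAME; no estimate; no new definition):
* ★★ **`t8P₂DK2Per_of_socketsSrc_γ'`** — `B8Thm8Surviving.Thm8SurvivingAt 1 λ.B₁ λ.B₂ (fun j : IdxB8SubDPerκ θ P Mκ Rκ => zdGF3HP₂Per θ.𝔸 θ.L λ.β λ.len j.1.1.1.1.1.1 P)` from
  Theorem 8's constants `cP cu cP3 γ₈ γ′ γ″ γβ B₈ B₈β` with the layer equations and guards (p616586's, verbatim) and the five sourced sockets at the (1.5) law members.
* ★★ **`t8P₂DK2Per_of_lettersSrc_γ'`** — the same with the four Prop-5-type sockets SERVED from [4]'s letters `SLet SLetUB` + `SH59src` (dag-n05-w4's member-uniform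
  thresholds, unchanged — they are per member).
HONEST FRAMING: kernel bookkeeping by name; the sockets are HYPOTHESES ([Balaban1985BackgroundPropagators]-type statements with source at the law members; N06 content,
`m ≥ 1` OPEN; NOT claimed); ONE conjunct of the periodic δ₂-slot, not the slot; count-neutral; **N05 NOT discharged**; Bałaban AS PRINTED with locators (Thm 8 in its
SURVIVING form, GAPS G-B8-13; print's torus `T_η` read as `P`-periodic data on `ℤᵈ`); constants sufficient, not optimal; one finite 𝕋⁴ programme at fixed ε; nothing
continuum ∕ ℝ⁴ ∕ OS ∕ mass-gap ∕ Clay.  No `sorry`, no new definition.  Unit `pub-ymgap-dag-n05-d` (g14), 2026-08-28.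
[cite: Balaban1985RegularSpaces, Thm 8 (1.146) p.101, Thm 4 p.88, Prop. 3 p.87, Prop. 5 (1.106)–(1.110) p.94, (1.3)–(1.5) p.77, p.77 («Ω_j ⊂ T_η»), (1.31) p.82, (1.35)–(1.36) p.82, (1.59)–(1.62) pp.86–87; Balaban1985BackgroundPropagators, Thm 3.1 p.397, Thm 3.3 p.398, (3.40) p.397]
-/

noncomputable section

namespace Summit.QuantumFields.YangMills.BalabanUVNodes.N05SubBP2DK2PerT8SrvGammaPrime

open Literature.MathematicalPhysics.QuantumFieldTheory.Balaban1983to89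
open Literature.MathematicalPhysics.QuantumFieldTheory.Balaban1983to89.Node00
open Literature.MathematicalPhysics.QuantumFieldTheory.Balaban1983to89.B8Eq134Admissible (Admissible134)
open Literature.MathematicalPhysics.QuantumFieldTheory.Balaban1983to89.B8IdxB8LawsB (IdxB8LawsB IdxB8SubB)
open Literature.MathematicalPhysics.QuantumFieldTheory.Balaban1983to89.B8LeafModelZd (ZdIdx)
open Literature.MathematicalPhysics.QuantumFieldTheory.Balaban1983to89.B8LeafModelZd3P (zdGF3HP)
open Literature.MathematicalPhysics.QuantumFieldTheory.Balaban1983to89.B8LeafModelZd3P2 (zdGF3HP₂)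
open Literature.MathematicalPhysics.QuantumFieldTheory.Balaban1983to89.B8TowerBondsPrinted (towerBondsP)
open Literature.MathematicalPhysics.QuantumFieldTheory.Balaban1983to89.B8Lemma1NonAbelian (mulCfg)
open Literature.MathematicalPhysics.QuantumFieldTheory.Balaban1983to89.B8Thm8SurvivingZdGF3HP2PerMapLanEGamma (thm8SurvivingAt_zdGF3HP₂Per_map_lanE_γ')
open Literature.MathematicalPhysics.QuantumFieldTheory.Balaban1983to89.B8LeafModelZdHP2Per (zdGF3HP₂Per)
open Literature.MathematicalPhysics.QuantumFieldTheory.Balaban1983to89.B8Prop3SrcZd3HP2Gamma (sp3src_zdGF3HP₂_map_of_sockB9P3srcHP₂_γ)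
open Literature.MathematicalPhysics.QuantumFieldTheory.Balaban1983to89.B8LanF146 (LanF146 lanF146_top_iff)
open Literature.MathematicalPhysics.QuantumFieldTheory.Balaban1983to89.B8SockLettersRD (SockLettersRD)
open Literature.MathematicalPhysics.QuantumFieldTheory.Balaban1983to89.B8SockSP5UniformThresholdsSrcGammaPrime (exists_uniform_threshold_sp5_src_γ' exists_uniform_threshold_sp5base_src_γ' exists_uniform_threshold_sp5u_src_γ')
open B7Eq78Linearization (zdBlocking QprimeIter)
open B8Eq119TwistedAxial (bgT)
open B8Eq138LandauZd (QT)
open B8Eq1117Concrete (XSpace)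
open B8Prop5ContractionKLevel (Bd2)
open B8LambdaSpaceKLevel (wt)
open MatrixLog B7Prop1Explicit B7Prop2Explicit B7Prop1Local B7Eq92Concrete
open B8Ineq130 (tlo thi)
open B8Ineq132 (InAk covDerivFwd)
open B8Eq119TwistedAxial (Restr129 InAx)
open B8Eq140Level (SideTouches)
open B8Eq138LandauZd (covLap InR138 IsLandau146W)
open B8Eq184Proof (gaugeExp cfgExp)
open B8Eq146AExpansion (iEta plaqCovDeriv)
open B8Eq143PlaqExpansion (pdiv)
open B7Prop4GeneralLevels (linCovIter)
open B8Eq155JBound (Jcur wsup)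
open B8ScaledSupNorm (bondNorm msup Bdd)
open B9Eq340HolderZd (hquot AdmPair)

-- `Site` alone could resolve to the torus sites of `Setup.lean`; re-export the `ℤ^d` sites of `B7Prop1Explicit`.
export B7Prop1Explicit (Site)

section T8P

/-- ★★ **(EDITION «P₂D-PER») THEOREM 8's CONJUNCT OF THE PERIODIC δ₂-SLOT — `Thm8SurvivingAt 1 λ.B₁ λ.B₂ (zdGF3HP₂Per ∘ (·.1.1.1.1.1, P))` on `IdxB8SubDPerκ θ P Mκ Rκ` —
FROM THE PERIODIC γ′ THEOREM-8 SERVER, SOCKETS DISPLAYED AT THE (1.5) LAW MEMBERS** (p616586's `t8P₂D_of_socketsSrc_γ'` re-run on the periodic index; its docstring applies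
VERBATIM with `zdGF3HP₂Per … P` for `zdGF3HP₂`, `thm8SurvivingAt_zdGF3HP₂Per_map_lanE_γ'` for the server and one more `.1` in every accessor): for the record's `θ`
(`D ≥ 2`), residual layer `λ` with Theorem 8's constants and layer equations, IF at every `Ω₀ = ℤᵈ` (1.5) law member the four sourced sockets of Theorem 4's frame at
(1.146) hold in the γ′ letters below `cP` (`SP5base`, `SP5`, `SH59src`, `SP5u`) and the sourced b9 socket of Proposition 3's frame holds below `cP3` (`SB9srcHP`), THEN
Theorem 8 in its surviving form at `γ = 1` holds on the PERIODIC δ₂-family of record (`famB8OfRecordSubBP₂DPer θ λ.β λ.len P` by `rfl`).  Proof: `SP3src` by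
`sp3src_zdGF3HP₂_map_of_sockB9P3srcHP₂_γ` at `ι := (·.1.1.1.1.1)`; the periodic server at `ι := (·.1.1.1.1.1)`, `p := fun _ => P`, `LanF := LanF146`, the periodicity
binders `hΩ := j.1.periodic`, `hdvd := j.1.dvd`, `hΛs := j.1.isPeriodic_Λs le_rfl`; `γ₈ ↦ 1` by `thm8SurvivingAt_anti`.
[cite: Balaban1985RegularSpaces, Thm 8 (1.146) p.101, Thm 4 p.88, Prop. 3 p.87, Prop. 5 p.94, (1.31) p.82, (1.35) p.82, (1.59)–(1.62) pp.86–87, (1.5) p.77, p.77 («Ω_j ⊂ T_η»); Balaban1985BackgroundPropagators, Thm 3.3 p.398] -/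
theorem t8P₂DK2Per_of_socketsSrc_γ' {θ : Stage3Params} (lam : ResidB8 θ) (P Mκ Rκ : ℕ) (hD : 2 ≤ θ.D)
    {cP cu cP3 γ₈ γ' γ'' γβ B₈ B₈β : ℝ} (hcP : 0 < cP) (hcu : 0 < cu) (hcP3 : 0 < cP3) (hγ₈ : 1 ≤ γ₈) (hγ' : 0 ≤ γ') (hγ'' : 0 ≤ γ'')
    (hB : 2 ≤ 5 * (θ.D : ℝ) * θ.L * lam.inp.B₀) (hB₀β : 0 < lam.B₀β) (hB₀8 : lam.inp.B₀ ≤ B₈)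
    (hγB : 5 * (θ.D : ℝ) * θ.L * lam.inp.B₀ + 2 * (γ' * lam.inp.B₀) ≤ 5 * (θ.D : ℝ) * θ.L * B₈)
    (hγB'' : 5 * (θ.D : ℝ) * θ.L * lam.inp.B₀ + 2 * (γ'' * lam.inp.B₀) ≤ 5 * (θ.D : ℝ) * θ.L * B₈)
    (hB8β : 5 * (θ.D : ℝ) * θ.L * lam.B₀β + 2 * lam.B₀β * (γ'' * lam.inp.B₀) + γβ ≤ 5 * (θ.D : ℝ) * θ.L * B₈β)
    (hB₁eq : lam.B₁ = 5 * (θ.D : ℝ) * θ.L * B₈ * (1 + 11 * (θ.D : ℝ) ^ 2)) (hB₂eq : lam.B₂ = 5 * (θ.D : ℝ) * θ.L * B₈β * (1 + 11 * (θ.D : ℝ) ^ 2))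
    -- THE FOUR SOURCED SOCKETS OF THEOREM 4's FRAME AT (1.146), γ′ LETTERS (one-end-point (1.35) antecedent; `|B₁|` over print's class `towerBondsP`), at the `Ω₀ = ℤᵈ` LAW
    -- MEMBERS ONLY, below ONE threshold `cP` (Prop. 5 ∃ base ∕ step with source, [4] Thm 3.3 with source, Prop. 5 ! with source) — HYPOTHESES (providers: dag-n05-w4 γ′ chain)
    (SP5base : ∀ i : ZdIdx θ.D θ.L, i.Ω 0 = Set.univ → IdxB8LawsB θ.L i → B8ConstraintBonds.DomainSeq θ.L i.Ω → (∀ l, l < i.k → ∀ z ∈ i.Λs i.k l, ((θ.L : ℤ) ^ l) • z ∈ B8ConstraintBonds.Lam θ.L i.Ω l) → Admissible134 θ.L Mκ Rκ i.k i.Ω → ∀ α₀ α₁ : ℝ, 0 < α₀ → 0 < α₁ → α₀ + α₁ ≤ cP →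
      ∀ U₀ U' : Site θ.D → Fin θ.D → θ.𝔸ˣ, (∀ x κ, U₀ x κ ∈ unitaryUnits θ.𝔸) → (∀ x κ, U' x κ ∈ unitaryUnits θ.𝔸) →
      ∀ φ : Site θ.D → θ.𝔸, ((InR138 θ.L i.k i.η (i.Ω 0) (i.Λs i.k) U₀ φ ∧ (∀ x, IsSelfAdjoint (φ x)) ∧ (∀ x, x ∉ i.Ω 0 → φ x = 0) ∧
          Bdd θ.L i.k i.η (-(2 : ℝ)) (fun j (x : Site θ.D) => x ∈ i.Ω j) φ) ∧
        msup θ.L i.k i.η (-(2 : ℝ)) (fun j (x : Site θ.D) => x ∈ i.Ω j) φ < γ₈ * (α₀ + α₁)) →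
      InAk θ.L i.k i.η α₀ i.Ω U₀ → InAk θ.L i.k i.η α₀ i.Ω (mulCfg U' U₀) → (∀ m, m ≤ i.k → InAx θ.L m (i.Λs m) U₀ (mulCfg U' U₀)) →
      (∀ j, j ≤ i.k → ∀ (z : Site θ.D) (μ : Fin θ.D),
        ((∀ x, InBox (tlo θ.L z j) (thi θ.L z j) x → x ∈ i.Ω j) ∨ (∀ x, InBox (tlo θ.L (z + e μ) j) (thi θ.L (z + e μ) j) x → x ∈ i.Ω j)) →
        ‖(avgIter θ.L (mulCfg U' U₀) j z μ : θ.𝔸) - (avgIter θ.L U₀ j z μ : θ.𝔸)‖ ≤ α₁) →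
      (∀ b ∈ {b : Site θ.D × Fin θ.D | SideTouches (i.Ω 0) b.1 b.2}, ‖((U' b.1 b.2 : θ.𝔸ˣ) : θ.𝔸) - 1‖ ≤ α₁) →
      (∃ (v : Site θ.D → θ.𝔸ˣ) (la : Site θ.D → θ.𝔸), (∀ x, v x ∈ unitaryUnits θ.𝔸) ∧ (∀ x, x ∉ i.Ω 0 → v x = 1) ∧
        (∀ j, j ≤ 1 → ∀ b ∈ {b : Site θ.D × Fin θ.D | SideTouches (i.Ω j) b.1 b.2}, (v b.1 : θ.𝔸) = ((gaugeExp la b.1 : θ.𝔸ˣ) : θ.𝔸) ∧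
        (v (b.1 + e b.2) : θ.𝔸) = ((gaugeExp la (b.1 + e b.2) : θ.𝔸ˣ) : θ.𝔸)) ∧
        (∀ j, j ≤ 1 → ∀ b ∈ {b : Site θ.D × Fin θ.D | SideTouches (i.Ω j) b.1 b.2},
        ‖la b.1‖ ≤ (8 * lam.inp.B₀' * (5 * (θ.D : ℝ) * θ.L * B₈) * (α₀ + α₁)) ∧ ((θ.L : ℝ) ^ j * i.η) * ‖covDerivFwd i.η U₀ b.2 la b.1‖ ≤ (8 * lam.inp.B₀' * (5 * (θ.D : ℝ) * θ.L * B₈) * (α₀ + α₁))) ∧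
        LanF146 θ.L i.k i.η (i.Ω 0) i.Λs U₀ φ 1 (mgauge U₀ v⁻¹ U') ∧ Restr129 θ.L 1 (i.Λs 1) U₀ ((1 : Site θ.D → θ.𝔸ˣ) * v)))
    (SP5 : ∀ i : ZdIdx θ.D θ.L, i.Ω 0 = Set.univ → IdxB8LawsB θ.L i → B8ConstraintBonds.DomainSeq θ.L i.Ω → (∀ l, l < i.k → ∀ z ∈ i.Λs i.k l, ((θ.L : ℤ) ^ l) • z ∈ B8ConstraintBonds.Lam θ.L i.Ω l) → Admissible134 θ.L Mκ Rκ i.k i.Ω → ∀ α₀ α₁ : ℝ, 0 < α₀ → 0 < α₁ → α₀ + α₁ ≤ cP →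
      ∀ U₀ U' : Site θ.D → Fin θ.D → θ.𝔸ˣ, (∀ x κ, U₀ x κ ∈ unitaryUnits θ.𝔸) → (∀ x κ, U' x κ ∈ unitaryUnits θ.𝔸) →
      ∀ φ : Site θ.D → θ.𝔸, ((InR138 θ.L i.k i.η (i.Ω 0) (i.Λs i.k) U₀ φ ∧ (∀ x, IsSelfAdjoint (φ x)) ∧ (∀ x, x ∉ i.Ω 0 → φ x = 0) ∧
          Bdd θ.L i.k i.η (-(2 : ℝ)) (fun j (x : Site θ.D) => x ∈ i.Ω j) φ) ∧
        msup θ.L i.k i.η (-(2 : ℝ)) (fun j (x : Site θ.D) => x ∈ i.Ω j) φ < γ₈ * (α₀ + α₁)) →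
      InAk θ.L i.k i.η α₀ i.Ω U₀ → InAk θ.L i.k i.η α₀ i.Ω (mulCfg U' U₀) → (∀ m, m ≤ i.k → InAx θ.L m (i.Λs m) U₀ (mulCfg U' U₀)) →
      (∀ j, j ≤ i.k → ∀ (z : Site θ.D) (μ : Fin θ.D),
        ((∀ x, InBox (tlo θ.L z j) (thi θ.L z j) x → x ∈ i.Ω j) ∨ (∀ x, InBox (tlo θ.L (z + e μ) j) (thi θ.L (z + e μ) j) x → x ∈ i.Ω j)) →
        ‖(avgIter θ.L (mulCfg U' U₀) j z μ : θ.𝔸) - (avgIter θ.L U₀ j z μ : θ.𝔸)‖ ≤ α₁) →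
      (∀ b ∈ {b : Site θ.D × Fin θ.D | SideTouches (i.Ω 0) b.1 b.2}, ‖((U' b.1 b.2 : θ.𝔸ˣ) : θ.𝔸) - 1‖ ≤ α₁) →
      (∀ m, 1 ≤ m → m < i.k → ∀ (u₁ : Site θ.D → θ.𝔸ˣ) (U₁ : Site θ.D → Fin θ.D → θ.𝔸ˣ) (A : Site θ.D → Fin θ.D → θ.𝔸),
        (∀ x, u₁ x ∈ unitaryUnits θ.𝔸) → (∀ x, x ∉ i.Ω 0 → u₁ x = 1) → mgauge U₀ u₁ U₁ = U' → Restr129 θ.L m (i.Λs m) U₀ u₁ →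
        LanF146 θ.L i.k i.η (i.Ω 0) i.Λs U₀ φ m U₁ →
        (∀ j, j ≤ m → ∀ b ∈ {b : Site θ.D × Fin θ.D | SideTouches (i.Ω j) b.1 b.2},
        U₁ b.1 b.2 = cfgExp i.η A b.1 b.2 ∧ IsSelfAdjoint (A b.1 b.2) ∧ ‖A b.1 b.2‖ ≤ (5 * (θ.D : ℝ) * θ.L * B₈ * (α₀ + α₁)) * ((θ.L : ℝ) ^ j * i.η)⁻¹) →
        ∃ (v : Site θ.D → θ.𝔸ˣ) (la : Site θ.D → θ.𝔸), (∀ x, v x ∈ unitaryUnits θ.𝔸) ∧ (∀ x, x ∉ i.Ω 0 → v x = 1) ∧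
        (∀ j, j ≤ m + 1 → ∀ b ∈ {b : Site θ.D × Fin θ.D | SideTouches (i.Ω j) b.1 b.2}, (v b.1 : θ.𝔸) = ((gaugeExp la b.1 : θ.𝔸ˣ) : θ.𝔸) ∧
        (v (b.1 + e b.2) : θ.𝔸) = ((gaugeExp la (b.1 + e b.2) : θ.𝔸ˣ) : θ.𝔸)) ∧
        (∀ j, j ≤ m + 1 → ∀ b ∈ {b : Site θ.D × Fin θ.D | SideTouches (i.Ω j) b.1 b.2},
        ‖la b.1‖ ≤ (8 * lam.inp.B₀' * (5 * (θ.D : ℝ) * θ.L * B₈) * (α₀ + α₁)) ∧ ((θ.L : ℝ) ^ j * i.η) * ‖covDerivFwd i.η U₀ b.2 la b.1‖ ≤ (8 * lam.inp.B₀' * (5 * (θ.D : ℝ) * θ.L * B₈) * (α₀ + α₁))) ∧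
        LanF146 θ.L i.k i.η (i.Ω 0) i.Λs U₀ φ (m + 1) (mgauge U₀ v⁻¹ U₁) ∧ Restr129 θ.L (m + 1) (i.Λs (m + 1)) U₀ (u₁ * v)))
    (SH59src : ∀ i : ZdIdx θ.D θ.L, i.Ω 0 = Set.univ → IdxB8LawsB θ.L i → B8ConstraintBonds.DomainSeq θ.L i.Ω → (∀ l, l < i.k → ∀ z ∈ i.Λs i.k l, ((θ.L : ℤ) ^ l) • z ∈ B8ConstraintBonds.Lam θ.L i.Ω l) → Admissible134 θ.L Mκ Rκ i.k i.Ω → ∀ α₀ α₁ : ℝ, 0 < α₀ → 0 < α₁ → α₀ + α₁ ≤ cP →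
      ∀ U₀ U' : Site θ.D → Fin θ.D → θ.𝔸ˣ, (∀ x κ, U₀ x κ ∈ unitaryUnits θ.𝔸) → (∀ x κ, U' x κ ∈ unitaryUnits θ.𝔸) →
      ∀ φ : Site θ.D → θ.𝔸, ((InR138 θ.L i.k i.η (i.Ω 0) (i.Λs i.k) U₀ φ ∧ (∀ x, IsSelfAdjoint (φ x)) ∧ (∀ x, x ∉ i.Ω 0 → φ x = 0) ∧
          Bdd θ.L i.k i.η (-(2 : ℝ)) (fun j (x : Site θ.D) => x ∈ i.Ω j) φ) ∧
        msup θ.L i.k i.η (-(2 : ℝ)) (fun j (x : Site θ.D) => x ∈ i.Ω j) φ < γ₈ * (α₀ + α₁)) →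
      InAk θ.L i.k i.η α₀ i.Ω U₀ → InAk θ.L i.k i.η α₀ i.Ω (mulCfg U' U₀) → (∀ m, m ≤ i.k → InAx θ.L m (i.Λs m) U₀ (mulCfg U' U₀)) →
      (∀ j, j ≤ i.k → ∀ (z : Site θ.D) (μ : Fin θ.D),
        ((∀ x, InBox (tlo θ.L z j) (thi θ.L z j) x → x ∈ i.Ω j) ∨ (∀ x, InBox (tlo θ.L (z + e μ) j) (thi θ.L (z + e μ) j) x → x ∈ i.Ω j)) →
        ‖(avgIter θ.L (mulCfg U' U₀) j z μ : θ.𝔸) - (avgIter θ.L U₀ j z μ : θ.𝔸)‖ ≤ α₁) →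
      (∀ b ∈ {b : Site θ.D × Fin θ.D | SideTouches (i.Ω 0) b.1 b.2}, ‖((U' b.1 b.2 : θ.𝔸ˣ) : θ.𝔸) - 1‖ ≤ α₁) →
      (∀ m, 1 ≤ m → m ≤ i.k → ∀ (u : Site θ.D → θ.𝔸ˣ) (W : Site θ.D → Fin θ.D → θ.𝔸ˣ) (A' : Site θ.D → Fin θ.D → θ.𝔸),
        (∀ x, u x ∈ unitaryUnits θ.𝔸) → mgauge U₀ u W = U' → Restr129 θ.L m (i.Λs m) U₀ u → LanF146 θ.L i.k i.η (i.Ω 0) i.Λs U₀ φ m W →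
        (∀ y τ, IsSelfAdjoint (A' y τ)) →
        (∀ j, j ≤ m → ∀ y τ, SideTouches (i.Ω j) y τ →
        W y τ = cfgExp i.η A' y τ ∧ ‖A' y τ‖ ≤ (2 * (θ.L * (5 * (θ.D : ℝ) * θ.L * B₈ * (α₀ + α₁))) + 8 * (8 * lam.inp.B₀' * (5 * (θ.D : ℝ) * θ.L * B₈) * (α₀ + α₁))) * ((θ.L : ℝ) ^ j * i.η)⁻¹) →
        (∀ y τ, (∀ j, j ≤ m → ¬ SideTouches (i.Ω j) y τ) → A' y τ = 0) →
        msup θ.L m i.η (-(1 : ℝ)) (fun j (b : Site θ.D × Fin θ.D) => SideTouches (i.Ω j) b.1 b.2) (fun b => A' b.1 b.2)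
        ≤ lam.inp.B₀ * (bondNorm θ.L m i.η (-(3 : ℝ)) i.Ω (fun x μ => Jcur i.η U₀ A' μ x)
        + wsup 1 (fun p : {p : ℕ × (Site θ.D × Fin θ.D) // p.1 ≤ m ∧ p.2 ∈ towerBondsP θ.L i.Ω (i.Λs m) p.1} =>
        linCovIter θ.L U₀ (iEta i.η A') p.1.1 p.1.2.1 p.1.2.2)) + γ' * lam.inp.B₀ * (α₀ + α₁) ∧
        msup θ.L m i.η (-(2 : ℝ)) (fun j (t : Fin θ.D × Fin θ.D × Site θ.D) => SideTouches (i.Ω j) t.2.2 t.2.1)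
        (fun t => covDerivFwd i.η U₀ t.1 (fun z => A' z t.2.1) t.2.2)
        ≤ lam.inp.B₀ * (bondNorm θ.L m i.η (-(3 : ℝ)) i.Ω (fun x μ => Jcur i.η U₀ A' μ x)
        + wsup 1 (fun p : {p : ℕ × (Site θ.D × Fin θ.D) // p.1 ≤ m ∧ p.2 ∈ towerBondsP θ.L i.Ω (i.Λs m) p.1} =>
        linCovIter θ.L U₀ (iEta i.η A') p.1.1 p.1.2.1 p.1.2.2)) + γ' * lam.inp.B₀ * (α₀ + α₁)))
    (SP5u : ∀ i : ZdIdx θ.D θ.L, i.Ω 0 = Set.univ → IdxB8LawsB θ.L i → B8ConstraintBonds.DomainSeq θ.L i.Ω → (∀ l, l < i.k → ∀ z ∈ i.Λs i.k l, ((θ.L : ℤ) ^ l) • z ∈ B8ConstraintBonds.Lam θ.L i.Ω l) → Admissible134 θ.L Mκ Rκ i.k i.Ω → ∀ α₀ α₁ : ℝ, 0 < α₀ → 0 < α₁ → α₀ + α₁ ≤ cP →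
      ∀ U₀ U' : Site θ.D → Fin θ.D → θ.𝔸ˣ, (∀ x κ, U₀ x κ ∈ unitaryUnits θ.𝔸) → (∀ x κ, U' x κ ∈ unitaryUnits θ.𝔸) →
      ∀ φ : Site θ.D → θ.𝔸, ((InR138 θ.L i.k i.η (i.Ω 0) (i.Λs i.k) U₀ φ ∧ (∀ x, IsSelfAdjoint (φ x)) ∧ (∀ x, x ∉ i.Ω 0 → φ x = 0) ∧
          Bdd θ.L i.k i.η (-(2 : ℝ)) (fun j (x : Site θ.D) => x ∈ i.Ω j) φ) ∧
        msup θ.L i.k i.η (-(2 : ℝ)) (fun j (x : Site θ.D) => x ∈ i.Ω j) φ < γ₈ * (α₀ + α₁)) →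
      InAk θ.L i.k i.η α₀ i.Ω U₀ → InAk θ.L i.k i.η α₀ i.Ω (mulCfg U' U₀) → (∀ m, m ≤ i.k → InAx θ.L m (i.Λs m) U₀ (mulCfg U' U₀)) →
      (∀ j, j ≤ i.k → ∀ (z : Site θ.D) (μ : Fin θ.D),
        ((∀ x, InBox (tlo θ.L z j) (thi θ.L z j) x → x ∈ i.Ω j) ∨ (∀ x, InBox (tlo θ.L (z + e μ) j) (thi θ.L (z + e μ) j) x → x ∈ i.Ω j)) →
        ‖(avgIter θ.L (mulCfg U' U₀) j z μ : θ.𝔸) - (avgIter θ.L U₀ j z μ : θ.𝔸)‖ ≤ α₁) →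
      (∀ b ∈ {b : Site θ.D × Fin θ.D | SideTouches (i.Ω 0) b.1 b.2}, ‖((U' b.1 b.2 : θ.𝔸ˣ) : θ.𝔸) - 1‖ ≤ α₁) →
      ∀ u₁ : Site θ.D → θ.𝔸ˣ, (∀ x, u₁ x ∈ unitaryUnits θ.𝔸) → (∀ x, x ∉ i.Ω 0 → u₁ x = 1) → Restr129 θ.L i.k (i.Λs i.k) U₀ u₁ →
      LanF146 θ.L i.k i.η (i.Ω 0) i.Λs U₀ φ i.k (mgauge U₀ u₁⁻¹ U') →
      (∃ A₁ : Site θ.D → Fin θ.D → θ.𝔸, ∀ j, j ≤ i.k → ∀ (x : Site θ.D) (κ : Fin θ.D), SideTouches (i.Ω j) x κ →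
        mgauge U₀ u₁⁻¹ U' x κ = cfgExp i.η A₁ x κ ∧ ‖A₁ x κ‖ ≤ (5 * (θ.D : ℝ) * θ.L * B₈ * (α₀ + α₁)) * ((θ.L : ℝ) ^ j * i.η)⁻¹) →
      ∀ (v w : Site θ.D → θ.𝔸ˣ) (la mu : Site θ.D → θ.𝔸),
      (∀ x, ((gaugeExp la x : θ.𝔸ˣ) : θ.𝔸) = ((v x : θ.𝔸ˣ) : θ.𝔸) ∧ IsSelfAdjoint (la x) ∧ ‖la x‖ < cu) → (∀ x, x ∉ i.Ω 0 → la x = 0) →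
      (∀ j, j ≤ i.k → ∀ b ∈ {b : Site θ.D × Fin θ.D | SideTouches (i.Ω j) b.1 b.2}, ((θ.L : ℝ) ^ j * i.η) * ‖covDerivFwd i.η U₀ b.2 la b.1‖ < cu) →
      (∀ x, ((gaugeExp mu x : θ.𝔸ˣ) : θ.𝔸) = ((w x : θ.𝔸ˣ) : θ.𝔸) ∧ IsSelfAdjoint (mu x) ∧ ‖mu x‖ < cu) → (∀ x, x ∉ i.Ω 0 → mu x = 0) →
      (∀ j, j ≤ i.k → ∀ b ∈ {b : Site θ.D × Fin θ.D | SideTouches (i.Ω j) b.1 b.2}, ((θ.L : ℝ) ^ j * i.η) * ‖covDerivFwd i.η U₀ b.2 mu b.1‖ < cu) →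
      LanF146 θ.L i.k i.η (i.Ω 0) i.Λs U₀ φ i.k (mgauge U₀ v⁻¹ (mgauge U₀ u₁⁻¹ U')) → Restr129 θ.L i.k (i.Λs i.k) U₀ (u₁ * v) →
      LanF146 θ.L i.k i.η (i.Ω 0) i.Λs U₀ φ i.k (mgauge U₀ w⁻¹ (mgauge U₀ u₁⁻¹ U')) → Restr129 θ.L i.k (i.Λs i.k) U₀ (u₁ * w) →
      ∀ x, v x = w x)
    -- THE SOURCED b9 SOCKET OF PROPOSITION 3's FRAME at the `Ω₀ = ℤᵈ` law members, threshold `cP3`, `|B₁|` over print's class at the top truncation — HYPOTHESIS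
    -- ([Balaban1985BackgroundPropagators] Thm 3.3 with source; = `B8Prop3SrcZd3HPGamma`'s input letter for letter)
    (SB9srcHP : ∀ i : ZdIdx θ.D θ.L, i.Ω 0 = Set.univ → IdxB8LawsB θ.L i → B8ConstraintBonds.DomainSeq θ.L i.Ω → (∀ l, l < i.k → ∀ z ∈ i.Λs i.k l, ((θ.L : ℤ) ^ l) • z ∈ B8ConstraintBonds.Lam θ.L i.Ω l) → Admissible134 θ.L Mκ Rκ i.k i.Ω → ∀ α₀ α₁ α₂ : ℝ, 0 < α₀ → α₀ ≤ cP3 → 0 < α₁ → 0 < α₂ → α₂ ≤ cP3 →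
      ∀ (U₀ W : Site θ.D → Fin θ.D → θ.𝔸ˣ), (∀ x κ, U₀ x κ ∈ unitaryUnits θ.𝔸) → (∀ x κ, W x κ ∈ unitaryUnits θ.𝔸) →
      ∀ f : Site θ.D → θ.𝔸, InR138 θ.L i.k i.η (i.Ω 0) (i.Λs i.k) U₀ f →
      (∀ x, IsSelfAdjoint (f x)) → (∀ x, x ∉ i.Ω 0 → f x = 0) →
      Bdd θ.L i.k i.η (-(2 : ℝ)) (fun j (x : Site θ.D) => x ∈ i.Ω j) f →
      msup θ.L i.k i.η (-(2 : ℝ)) (fun j (x : Site θ.D) => x ∈ i.Ω j) f < γ₈ * (α₀ + α₁) →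
      msup θ.L i.k i.η (-(3 : ℝ)) (fun j (p : Fin θ.D × Site θ.D) => p.2 ∈ i.Ω j) (fun p => covDerivFwd i.η U₀ p.1 f p.2) < γ₈ * (α₀ + α₁) →
      InAk θ.L i.k i.η α₀ i.Ω U₀ → InAk θ.L i.k i.η α₀ i.Ω (mulCfg W U₀) → IsLandau146W θ.L i.k i.η (i.Ω 0) (i.Λs i.k) U₀ f W →
      ∀ A' : Site θ.D → Fin θ.D → θ.𝔸, (∀ y τ, IsSelfAdjoint (A' y τ)) →
      (∀ j, j ≤ i.k → ∀ (y : Site θ.D) (τ : Fin θ.D), SideTouches (i.Ω j) y τ →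
        W y τ = cfgExp i.η A' y τ ∧ ‖A' y τ‖ ≤ α₂ * ((θ.L : ℝ) ^ j * i.η)⁻¹) →
      (∀ (y : Site θ.D) (τ : Fin θ.D), (∀ j, j ≤ i.k → ¬ SideTouches (i.Ω j) y τ) → A' y τ = 0) →
      msup θ.L i.k i.η (-(1 : ℝ)) (fun j (b : Site θ.D × Fin θ.D) => SideTouches (i.Ω j) b.1 b.2) (fun b => A' b.1 b.2)
          ≤ lam.inp.B₀ * (bondNorm θ.L i.k i.η (-(3 : ℝ)) i.Ω (fun x μ => Jcur i.η U₀ A' μ x)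
            + wsup 1 (fun p : {p : ℕ × (Site θ.D × Fin θ.D) // p.1 ≤ i.k ∧ p.2 ∈ towerBondsP θ.L i.Ω (i.Λs i.k) p.1} =>
                linCovIter θ.L U₀ (iEta i.η A') p.1.1 p.1.2.1 p.1.2.2)) + γ'' * lam.inp.B₀ * (α₀ + α₁) ∧
        msup θ.L i.k i.η (-(2 : ℝ)) (fun j (t : Fin θ.D × Fin θ.D × Site θ.D) => SideTouches (i.Ω j) t.2.2 t.2.1)
            (fun t => covDerivFwd i.η U₀ t.1 (fun z => A' z t.2.1) t.2.2)
          ≤ lam.inp.B₀ * (bondNorm θ.L i.k i.η (-(3 : ℝ)) i.Ω (fun x μ => Jcur i.η U₀ A' μ x)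
            + wsup 1 (fun p : {p : ℕ × (Site θ.D × Fin θ.D) // p.1 ≤ i.k ∧ p.2 ∈ towerBondsP θ.L i.Ω (i.Λs i.k) p.1} =>
                linCovIter θ.L U₀ (iEta i.η A') p.1.1 p.1.2.1 p.1.2.2)) + γ'' * lam.inp.B₀ * (α₀ + α₁) ∧
        bondNorm θ.L i.k i.η (-(3 : ℝ)) i.Ω (fun x μ => pdiv i.η U₀ (plaqCovDeriv i.η U₀ A') μ x)
          ≤ lam.inp.B₀ * (bondNorm θ.L i.k i.η (-(3 : ℝ)) i.Ω (fun x μ => Jcur i.η U₀ A' μ x)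
            + wsup 1 (fun p : {p : ℕ × (Site θ.D × Fin θ.D) // p.1 ≤ i.k ∧ p.2 ∈ towerBondsP θ.L i.Ω (i.Λs i.k) p.1} =>
                linCovIter θ.L U₀ (iEta i.η A') p.1.1 p.1.2.1 p.1.2.2)) + γ'' * lam.inp.B₀ * (α₀ + α₁) ∧
        bondNorm θ.L i.k i.η (-(3 : ℝ)) i.Ω (fun x μ => covLap i.η U₀ (fun z => A' z μ) x)
          ≤ lam.inp.B₀ * (bondNorm θ.L i.k i.η (-(3 : ℝ)) i.Ω (fun x μ => Jcur i.η U₀ A' μ x)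
            + wsup 1 (fun p : {p : ℕ × (Site θ.D × Fin θ.D) // p.1 ≤ i.k ∧ p.2 ∈ towerBondsP θ.L i.Ω (i.Λs i.k) p.1} =>
                linCovIter θ.L U₀ (iEta i.η A') p.1.1 p.1.2.1 p.1.2.2)) + γ'' * lam.inp.B₀ * (α₀ + α₁) ∧
        msup θ.L i.k i.η (-(2 + lam.β)) (fun j (q : Fin θ.D × Fin θ.D × (Site θ.D × Site θ.D)) => q.2.2 ∈ AdmPair i.η lam.len ∧ q.2.2.1 ∈ i.Ω j ∧ q.2.2.2 ∈ i.Ω j)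
            (fun q => hquot i.η lam.β lam.len U₀ (covDerivFwd i.η U₀ q.1 (fun z => A' z q.2.1)) q.2.2)
          ≤ lam.B₀β * (bondNorm θ.L i.k i.η (-(3 : ℝ)) i.Ω (fun x μ => Jcur i.η U₀ A' μ x)
            + wsup 1 (fun p : {p : ℕ × (Site θ.D × Fin θ.D) // p.1 ≤ i.k ∧ p.2 ∈ towerBondsP θ.L i.Ω (i.Λs i.k) p.1} =>
                linCovIter θ.L U₀ (iEta i.η A') p.1.1 p.1.2.1 p.1.2.2)) + γβ * (α₀ + α₁)) :
    B8Thm8Surviving.Thm8SurvivingAt 1 lam.B₁ lam.B₂ (fun j : IdxB8SubDPerκ θ P Mκ Rκ => zdGF3HP₂Per θ.𝔸 θ.L lam.β lam.len j.1.1.1.1.1.1 P) := by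
  -- constants: `0 < B₀ ≤ B₈`, `2 ≤ 5dLB₀ ≤ 5dLB₈`
  have hB₀ : 0 < lam.inp.B₀ := lam.inp.B₀_pos
  have hB₈ : 0 < B₈ := lt_of_lt_of_le hB₀ hB₀8
  have h5 : 0 ≤ 5 * (θ.D : ℝ) * θ.L := by positivity
  have hB8' : 2 ≤ 5 * (θ.D : ℝ) * θ.L * B₈ := hB.trans (mul_le_mul_of_nonneg_left hB₀8 h5)
  -- PROPOSITION 3 WITH SOURCE on the P-carrier at the law members from the sourced b9 socket in Prop. 3's frame (D7-2b): `SP3src` at `ι := j ↦ j.1.1.1.1.1.1`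
  obtain ⟨cP3', hcP3', SP3src⟩ := sp3src_zdGF3HP₂_map_of_sockB9P3srcHP₂_γ (𝔸 := θ.𝔸) (γ := γ₈) hD θ.two_le_L hB₀ hB₀β.le hcP3 hγ'' hγB'' hB8β lam.β lam.len
    (fun j : IdxB8SubDPerκ θ P Mκ Rκ => j.1.1.1.1.1.1) (fun j => SB9srcHP j.1.1.1.1.1.1 j.1.1.1.1.1.2 j.1.1.1.1.2 j.1.1.1.2 j.1.1.2 j.2)
  -- THEOREM 8 (surviving) on the P-carrier at the law members: the PERIODIC server (CLAIM-7) at `ι := (·.1.1.1.1.1)`, `p := fun _ => P`, `LanF := LanF146`, tower law from the sub-index, periodicity binders from the index, then `γ₈ ↦ 1`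
  have t8γ := thm8SurvivingAt_zdGF3HP₂Per_map_lanE_γ' (𝔸 := θ.𝔸) (β := lam.β) (len := lam.len) hD θ.two_le_L hB₀ lam.inp.B₀'_pos hcu hcP hcP3'
    (lt_of_lt_of_le one_pos hγ₈) hγ' hB₈ hB₀8 hB8' hγB (fun j : IdxB8SubDPerκ θ P Mκ Rκ => j.1.1.1.1.1.1) (fun j => j.1.1.1.1.1.2) (fun j => IdxB8SubB.tower_all j.1.1.1.1)
    (fun j U₀ f m W => LanF146 θ.L j.1.1.1.1.1.1.k j.1.1.1.1.1.1.η (j.1.1.1.1.1.1.Ω 0) j.1.1.1.1.1.1.Λs U₀ f m W)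
    (fun j U₀ f W => lanF146_top_iff θ.L j.1.1.1.1.1.1.k j.1.1.1.1.1.1.η (j.1.1.1.1.1.1.Ω 0) j.1.1.1.1.1.1.Λs U₀ f W)
    (fun j => SP5base j.1.1.1.1.1.1 j.1.1.1.1.1.2 j.1.1.1.1.2 j.1.1.1.2 j.1.1.2 j.2) (fun j => SP5 j.1.1.1.1.1.1 j.1.1.1.1.1.2 j.1.1.1.1.2 j.1.1.1.2 j.1.1.2 j.2)
    (fun j => SH59src j.1.1.1.1.1.1 j.1.1.1.1.1.2 j.1.1.1.1.2 j.1.1.1.2 j.1.1.2 j.2) (fun j => SP5u j.1.1.1.1.1.1 j.1.1.1.1.1.2 j.1.1.1.1.2 j.1.1.1.2 j.1.1.2 j.2) SP3src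
    (fun _ => P) (fun j l => j.1.periodic l) (fun j => j.1.dvd) (fun j _ hl => j.1.isPeriodic_Λs le_rfl hl)
  rw [hB₁eq, hB₂eq]
  exact B8Thm8Surviving.thm8SurvivingAt_anti _ hγ₈ t8γ

/-- ★★ **(EDITION «P₂D-PER») THE SAME WITH THE PROP-5-TYPE SOCKETS SERVED FROM [4]'s LETTERS AT THE (1.5) LAW MEMBERS** (p616586's `t8P₂D_of_lettersSrc_γ'` re-run on
the periodic index; its docstring applies VERBATIM): the conclusion `Thm8SurvivingAt 1 λ.B₁ λ.B₂ (zdGF3HP₂Per ∘ (·.1.1.1.1.1, P))` from [4]'s letters at the `Ω₀ = ℤᵈ` law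
members (`SLet`, `SLetUB`), the sourced free-constant guard `3·(2dL²)·B_G·B_R·(B₈ + γ₈) ≤ B₀′·B₈`, Theorem 8's constants and layer equations, and the TWO sourced b9 sockets
`SH59src` (threshold `c59`) and `SB9srcHP` (threshold `cP3`) — the Prop-5-type sockets INSIDE by dag-n05-w4's member-uniform thresholds (per `ZdIdx` member, period-blind),
then `t8P₂DK2Per_of_socketsSrc_γ'` at `cP := min c59 (min cPb (min cP5 cPu))`.
[cite: Balaban1985RegularSpaces, Thm 8 (1.146) p.101, Prop. 5 (1.106)–(1.110) p.94, Thm 4 p.88, Prop. 3 p.87, (1.31) p.82, (1.35) p.82, p.77 («Ω_j ⊂ T_η»); Balaban1985BackgroundPropagators, Thm 3.1 p.397, Thm 3.3 p.398] -/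
theorem t8P₂DK2Per_of_lettersSrc_γ' {θ : Stage3Params} (lam : ResidB8 θ) (P Mκ Rκ : ℕ) (hD : 2 ≤ θ.D)
    {B₀'H B₂' BG BR cL : ℝ} (hB₀'H : 0 < B₀'H) (hB₂' : 0 ≤ B₂') (hBG : 0 ≤ BG) (hBR : 0 ≤ BR) (hcL : 0 < cL)
    -- [4]'s letters AT THE `Ω₀ = ℤᵈ` LAW MEMBERS ONLY: existence side (laws on print's domains) and uniqueness side
    (SLet : ∀ i : ZdIdx θ.D θ.L, i.Ω 0 = Set.univ → IdxB8LawsB θ.L i → B8ConstraintBonds.DomainSeq θ.L i.Ω → (∀ l, l < i.k → ∀ z ∈ i.Λs i.k l, ((θ.L : ℤ) ^ l) • z ∈ B8ConstraintBonds.Lam θ.L i.Ω l) → Admissible134 θ.L Mκ Rκ i.k i.Ω → SockLettersRD (𝔸 := θ.𝔸) θ.L BG BR B₀'H B₂' cL i.η i.k i.Ω i.Λs)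
    (SLetUB : ∀ i : ZdIdx θ.D θ.L, i.Ω 0 = Set.univ → IdxB8LawsB θ.L i → B8ConstraintBonds.DomainSeq θ.L i.Ω → (∀ l, l < i.k → ∀ z ∈ i.Λs i.k l, ((θ.L : ℤ) ^ l) • z ∈ B8ConstraintBonds.Lam θ.L i.Ω l) → Admissible134 θ.L Mκ Rκ i.k i.Ω → ∀ α₀ : ℝ, 0 < α₀ → α₀ ≤ cL → ∀ U₀ : Site θ.D → Fin θ.D → θ.𝔸ˣ, (∀ x κ, U₀ x κ ∈ unitaryUnits θ.𝔸) →
      InAk θ.L i.k i.η α₀ i.Ω U₀ →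
      ∃ (g Δ : (Site θ.D → θ.𝔸) →ₗ[ℂ] (Site θ.D → θ.𝔸)) (q : (Site θ.D → θ.𝔸) →ₗ[ℂ] (ℕ → Site θ.D → θ.𝔸))
        (qs : (ℕ → Site θ.D → θ.𝔸) →ₗ[ℂ] (Site θ.D → θ.𝔸)) (Aw c : (ℕ → Site θ.D → θ.𝔸) →ₗ[ℂ] (ℕ → Site θ.D → θ.𝔸))
        (H' : XSpace θ.D i.k θ.𝔸 →ₗ[ℂ] (Site θ.D → θ.𝔸)),
        (∀ x : Site θ.D → θ.𝔸, (∃ C : ℝ, ∀ y, ‖x y‖ ≤ C) → g (Δ x + qs (Aw (q x))) = x) ∧ (∀ φ, qs (c (q (g (g (qs φ))))) = qs φ) ∧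
        (∀ (f : Site θ.D → θ.𝔸), ∀ x ∈ i.Ω 0, Δ f x = covLap i.η U₀ ((i.Ω 0).indicator f) x) ∧
        (∀ (μ : ℕ → Site θ.D → θ.𝔸), ∀ x ∈ i.Ω 0, qs μ x = QT θ.L i.k (i.Λs i.k) U₀ μ x) ∧
        (∀ (f : Site θ.D → θ.𝔸) (n : ℕ), n ≤ i.k → ∀ y ∈ i.Λs i.k n, q f n y = QprimeIter (zdBlocking θ.D θ.L) (bgT θ.L U₀) n f y) ∧
        (∀ (f : Site θ.D → θ.𝔸) (n : ℕ) (y : Site θ.D), ¬ (n ≤ i.k ∧ y ∈ i.Λs i.k n) → q f n y = 0) ∧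
        (∀ (X : XSpace θ.D i.k θ.𝔸) (x : Site θ.D), ‖H' X x‖ ≤ B₀'H * ‖X‖) ∧
        (∀ n, n ≤ i.k → ∀ (X : XSpace θ.D i.k θ.𝔸), ∀ p ∈ {b : Site θ.D × Fin θ.D | SideTouches (i.Ω n) b.1 b.2},
          wt θ.L i.η n * ‖covDerivFwd i.η U₀ p.2 (H' X) p.1‖ ≤ B₀'H * ‖X‖) ∧
        (∀ X : XSpace θ.D i.k θ.𝔸, Bd2 θ.L i.η i.k i.Ω (covLap i.η U₀ (H' X)) (B₂' * ‖X‖)) ∧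
        (∀ (Y : XSpace θ.D i.k θ.𝔸) (n : ℕ) (hn : n ≤ i.k) (y : Site θ.D), y ∈ i.Λs i.k n →
          QprimeIter (zdBlocking θ.D θ.L) (bgT θ.L U₀) n (H' Y) y = Y (⟨n, Nat.lt_succ_of_le hn⟩, y)) ∧
        (∀ (f : Site θ.D → θ.𝔸) (r : ℝ), 0 ≤ r → Bd2 θ.L i.η i.k i.Ω f r →
          (∀ x, ‖g f x‖ ≤ BG * r) ∧ ∀ n, n ≤ i.k → ∀ p ∈ {b : Site θ.D × Fin θ.D | SideTouches (i.Ω n) b.1 b.2},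
            wt θ.L i.η n * ‖covDerivFwd i.η U₀ p.2 (g f) p.1‖ ≤ BG * r) ∧
        (∀ (f : Site θ.D → θ.𝔸) (r : ℝ), 0 ≤ r → Bd2 θ.L i.η i.k i.Ω f r → Bd2 θ.L i.η i.k i.Ω (f - g (qs (c (q (g f))))) (BR * r)))
    {c59 cP3 γ₈ γ' γ'' γβ B₈ B₈β : ℝ} (hc59 : 0 < c59) (hcP3 : 0 < cP3) (hγ₈ : 1 ≤ γ₈) (hγ' : 0 ≤ γ') (hγ'' : 0 ≤ γ'')
    (hB : 2 ≤ 5 * (θ.D : ℝ) * θ.L * lam.inp.B₀) (hB₀β : 0 < lam.B₀β) (hB₀8 : lam.inp.B₀ ≤ B₈)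
    (hγB : 5 * (θ.D : ℝ) * θ.L * lam.inp.B₀ + 2 * (γ' * lam.inp.B₀) ≤ 5 * (θ.D : ℝ) * θ.L * B₈)
    (hγB'' : 5 * (θ.D : ℝ) * θ.L * lam.inp.B₀ + 2 * (γ'' * lam.inp.B₀) ≤ 5 * (θ.D : ℝ) * θ.L * B₈)
    (hB8β : 5 * (θ.D : ℝ) * θ.L * lam.B₀β + 2 * lam.B₀β * (γ'' * lam.inp.B₀) + γβ ≤ 5 * (θ.D : ℝ) * θ.L * B₈β)
    (hB₁eq : lam.B₁ = 5 * (θ.D : ℝ) * θ.L * B₈ * (1 + 11 * (θ.D : ℝ) ^ 2)) (hB₂eq : lam.B₂ = 5 * (θ.D : ℝ) * θ.L * B₈β * (1 + 11 * (θ.D : ℝ) ^ 2))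
    (hfreeS : 3 * (2 * (θ.D : ℝ) * (θ.L : ℝ) ^ 2) * BG * BR * (B₈ + γ₈) ≤ lam.inp.B₀' * B₈)
    -- [Balaban1985BackgroundPropagators] Thm 3.3 WITH SOURCE in Theorem 4's frame at (1.146), γ′ letter, threshold `c59`, at the law members ONLY — HYPOTHESIS
    (SH59src : ∀ i : ZdIdx θ.D θ.L, i.Ω 0 = Set.univ → IdxB8LawsB θ.L i → B8ConstraintBonds.DomainSeq θ.L i.Ω → (∀ l, l < i.k → ∀ z ∈ i.Λs i.k l, ((θ.L : ℤ) ^ l) • z ∈ B8ConstraintBonds.Lam θ.L i.Ω l) → Admissible134 θ.L Mκ Rκ i.k i.Ω → ∀ α₀ α₁ : ℝ, 0 < α₀ → 0 < α₁ → α₀ + α₁ ≤ c59 →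
      ∀ U₀ U' : Site θ.D → Fin θ.D → θ.𝔸ˣ, (∀ x κ, U₀ x κ ∈ unitaryUnits θ.𝔸) → (∀ x κ, U' x κ ∈ unitaryUnits θ.𝔸) →
      ∀ φ : Site θ.D → θ.𝔸, ((InR138 θ.L i.k i.η (i.Ω 0) (i.Λs i.k) U₀ φ ∧ (∀ x, IsSelfAdjoint (φ x)) ∧ (∀ x, x ∉ i.Ω 0 → φ x = 0) ∧
          Bdd θ.L i.k i.η (-(2 : ℝ)) (fun j (x : Site θ.D) => x ∈ i.Ω j) φ) ∧
        msup θ.L i.k i.η (-(2 : ℝ)) (fun j (x : Site θ.D) => x ∈ i.Ω j) φ < γ₈ * (α₀ + α₁)) →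
      InAk θ.L i.k i.η α₀ i.Ω U₀ → InAk θ.L i.k i.η α₀ i.Ω (mulCfg U' U₀) → (∀ m, m ≤ i.k → InAx θ.L m (i.Λs m) U₀ (mulCfg U' U₀)) →
      (∀ j, j ≤ i.k → ∀ (z : Site θ.D) (μ : Fin θ.D),
        ((∀ x, InBox (tlo θ.L z j) (thi θ.L z j) x → x ∈ i.Ω j) ∨ (∀ x, InBox (tlo θ.L (z + e μ) j) (thi θ.L (z + e μ) j) x → x ∈ i.Ω j)) →
        ‖(avgIter θ.L (mulCfg U' U₀) j z μ : θ.𝔸) - (avgIter θ.L U₀ j z μ : θ.𝔸)‖ ≤ α₁) →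
      (∀ b ∈ {b : Site θ.D × Fin θ.D | SideTouches (i.Ω 0) b.1 b.2}, ‖((U' b.1 b.2 : θ.𝔸ˣ) : θ.𝔸) - 1‖ ≤ α₁) →
      (∀ m, 1 ≤ m → m ≤ i.k → ∀ (u : Site θ.D → θ.𝔸ˣ) (W : Site θ.D → Fin θ.D → θ.𝔸ˣ) (A' : Site θ.D → Fin θ.D → θ.𝔸),
        (∀ x, u x ∈ unitaryUnits θ.𝔸) → mgauge U₀ u W = U' → Restr129 θ.L m (i.Λs m) U₀ u → LanF146 θ.L i.k i.η (i.Ω 0) i.Λs U₀ φ m W →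
        (∀ y τ, IsSelfAdjoint (A' y τ)) →
        (∀ j, j ≤ m → ∀ y τ, SideTouches (i.Ω j) y τ →
        W y τ = cfgExp i.η A' y τ ∧ ‖A' y τ‖ ≤ (2 * (θ.L * (5 * (θ.D : ℝ) * θ.L * B₈ * (α₀ + α₁))) + 8 * (8 * lam.inp.B₀' * (5 * (θ.D : ℝ) * θ.L * B₈) * (α₀ + α₁))) * ((θ.L : ℝ) ^ j * i.η)⁻¹) →
        (∀ y τ, (∀ j, j ≤ m → ¬ SideTouches (i.Ω j) y τ) → A' y τ = 0) →
        msup θ.L m i.η (-(1 : ℝ)) (fun j (b : Site θ.D × Fin θ.D) => SideTouches (i.Ω j) b.1 b.2) (fun b => A' b.1 b.2)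
        ≤ lam.inp.B₀ * (bondNorm θ.L m i.η (-(3 : ℝ)) i.Ω (fun x μ => Jcur i.η U₀ A' μ x)
        + wsup 1 (fun p : {p : ℕ × (Site θ.D × Fin θ.D) // p.1 ≤ m ∧ p.2 ∈ towerBondsP θ.L i.Ω (i.Λs m) p.1} =>
        linCovIter θ.L U₀ (iEta i.η A') p.1.1 p.1.2.1 p.1.2.2)) + γ' * lam.inp.B₀ * (α₀ + α₁) ∧
        msup θ.L m i.η (-(2 : ℝ)) (fun j (t : Fin θ.D × Fin θ.D × Site θ.D) => SideTouches (i.Ω j) t.2.2 t.2.1)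
        (fun t => covDerivFwd i.η U₀ t.1 (fun z => A' z t.2.1) t.2.2)
        ≤ lam.inp.B₀ * (bondNorm θ.L m i.η (-(3 : ℝ)) i.Ω (fun x μ => Jcur i.η U₀ A' μ x)
        + wsup 1 (fun p : {p : ℕ × (Site θ.D × Fin θ.D) // p.1 ≤ m ∧ p.2 ∈ towerBondsP θ.L i.Ω (i.Λs m) p.1} =>
        linCovIter θ.L U₀ (iEta i.η A') p.1.1 p.1.2.1 p.1.2.2)) + γ' * lam.inp.B₀ * (α₀ + α₁)))
    -- THE SOURCED b9 SOCKET OF PROPOSITION 3's FRAME at the `Ω₀ = ℤᵈ` law members, threshold `cP3`, `|B₁|` over print's class at the top truncation — HYPOTHESIS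
    -- ([Balaban1985BackgroundPropagators] Thm 3.3 with source; = `B8Prop3SrcZd3HPGamma`'s input letter for letter)
    (SB9srcHP : ∀ i : ZdIdx θ.D θ.L, i.Ω 0 = Set.univ → IdxB8LawsB θ.L i → B8ConstraintBonds.DomainSeq θ.L i.Ω → (∀ l, l < i.k → ∀ z ∈ i.Λs i.k l, ((θ.L : ℤ) ^ l) • z ∈ B8ConstraintBonds.Lam θ.L i.Ω l) → Admissible134 θ.L Mκ Rκ i.k i.Ω → ∀ α₀ α₁ α₂ : ℝ, 0 < α₀ → α₀ ≤ cP3 → 0 < α₁ → 0 < α₂ → α₂ ≤ cP3 →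
      ∀ (U₀ W : Site θ.D → Fin θ.D → θ.𝔸ˣ), (∀ x κ, U₀ x κ ∈ unitaryUnits θ.𝔸) → (∀ x κ, W x κ ∈ unitaryUnits θ.𝔸) →
      ∀ f : Site θ.D → θ.𝔸, InR138 θ.L i.k i.η (i.Ω 0) (i.Λs i.k) U₀ f →
      (∀ x, IsSelfAdjoint (f x)) → (∀ x, x ∉ i.Ω 0 → f x = 0) →
      Bdd θ.L i.k i.η (-(2 : ℝ)) (fun j (x : Site θ.D) => x ∈ i.Ω j) f →
      msup θ.L i.k i.η (-(2 : ℝ)) (fun j (x : Site θ.D) => x ∈ i.Ω j) f < γ₈ * (α₀ + α₁) →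
      msup θ.L i.k i.η (-(3 : ℝ)) (fun j (p : Fin θ.D × Site θ.D) => p.2 ∈ i.Ω j) (fun p => covDerivFwd i.η U₀ p.1 f p.2) < γ₈ * (α₀ + α₁) →
      InAk θ.L i.k i.η α₀ i.Ω U₀ → InAk θ.L i.k i.η α₀ i.Ω (mulCfg W U₀) → IsLandau146W θ.L i.k i.η (i.Ω 0) (i.Λs i.k) U₀ f W →
      ∀ A' : Site θ.D → Fin θ.D → θ.𝔸, (∀ y τ, IsSelfAdjoint (A' y τ)) →
      (∀ j, j ≤ i.k → ∀ (y : Site θ.D) (τ : Fin θ.D), SideTouches (i.Ω j) y τ →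
        W y τ = cfgExp i.η A' y τ ∧ ‖A' y τ‖ ≤ α₂ * ((θ.L : ℝ) ^ j * i.η)⁻¹) →
      (∀ (y : Site θ.D) (τ : Fin θ.D), (∀ j, j ≤ i.k → ¬ SideTouches (i.Ω j) y τ) → A' y τ = 0) →
      msup θ.L i.k i.η (-(1 : ℝ)) (fun j (b : Site θ.D × Fin θ.D) => SideTouches (i.Ω j) b.1 b.2) (fun b => A' b.1 b.2)
          ≤ lam.inp.B₀ * (bondNorm θ.L i.k i.η (-(3 : ℝ)) i.Ω (fun x μ => Jcur i.η U₀ A' μ x)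
            + wsup 1 (fun p : {p : ℕ × (Site θ.D × Fin θ.D) // p.1 ≤ i.k ∧ p.2 ∈ towerBondsP θ.L i.Ω (i.Λs i.k) p.1} =>
                linCovIter θ.L U₀ (iEta i.η A') p.1.1 p.1.2.1 p.1.2.2)) + γ'' * lam.inp.B₀ * (α₀ + α₁) ∧
        msup θ.L i.k i.η (-(2 : ℝ)) (fun j (t : Fin θ.D × Fin θ.D × Site θ.D) => SideTouches (i.Ω j) t.2.2 t.2.1)
            (fun t => covDerivFwd i.η U₀ t.1 (fun z => A' z t.2.1) t.2.2)
          ≤ lam.inp.B₀ * (bondNorm θ.L i.k i.η (-(3 : ℝ)) i.Ω (fun x μ => Jcur i.η U₀ A' μ x)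
            + wsup 1 (fun p : {p : ℕ × (Site θ.D × Fin θ.D) // p.1 ≤ i.k ∧ p.2 ∈ towerBondsP θ.L i.Ω (i.Λs i.k) p.1} =>
                linCovIter θ.L U₀ (iEta i.η A') p.1.1 p.1.2.1 p.1.2.2)) + γ'' * lam.inp.B₀ * (α₀ + α₁) ∧
        bondNorm θ.L i.k i.η (-(3 : ℝ)) i.Ω (fun x μ => pdiv i.η U₀ (plaqCovDeriv i.η U₀ A') μ x)
          ≤ lam.inp.B₀ * (bondNorm θ.L i.k i.η (-(3 : ℝ)) i.Ω (fun x μ => Jcur i.η U₀ A' μ x)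
            + wsup 1 (fun p : {p : ℕ × (Site θ.D × Fin θ.D) // p.1 ≤ i.k ∧ p.2 ∈ towerBondsP θ.L i.Ω (i.Λs i.k) p.1} =>
                linCovIter θ.L U₀ (iEta i.η A') p.1.1 p.1.2.1 p.1.2.2)) + γ'' * lam.inp.B₀ * (α₀ + α₁) ∧
        bondNorm θ.L i.k i.η (-(3 : ℝ)) i.Ω (fun x μ => covLap i.η U₀ (fun z => A' z μ) x)
          ≤ lam.inp.B₀ * (bondNorm θ.L i.k i.η (-(3 : ℝ)) i.Ω (fun x μ => Jcur i.η U₀ A' μ x)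
            + wsup 1 (fun p : {p : ℕ × (Site θ.D × Fin θ.D) // p.1 ≤ i.k ∧ p.2 ∈ towerBondsP θ.L i.Ω (i.Λs i.k) p.1} =>
                linCovIter θ.L U₀ (iEta i.η A') p.1.1 p.1.2.1 p.1.2.2)) + γ'' * lam.inp.B₀ * (α₀ + α₁) ∧
        msup θ.L i.k i.η (-(2 + lam.β)) (fun j (q : Fin θ.D × Fin θ.D × (Site θ.D × Site θ.D)) => q.2.2 ∈ AdmPair i.η lam.len ∧ q.2.2.1 ∈ i.Ω j ∧ q.2.2.2 ∈ i.Ω j)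
            (fun q => hquot i.η lam.β lam.len U₀ (covDerivFwd i.η U₀ q.1 (fun z => A' z q.2.1)) q.2.2)
          ≤ lam.B₀β * (bondNorm θ.L i.k i.η (-(3 : ℝ)) i.Ω (fun x μ => Jcur i.η U₀ A' μ x)
            + wsup 1 (fun p : {p : ℕ × (Site θ.D × Fin θ.D) // p.1 ≤ i.k ∧ p.2 ∈ towerBondsP θ.L i.Ω (i.Λs i.k) p.1} =>
                linCovIter θ.L U₀ (iEta i.η A') p.1.1 p.1.2.1 p.1.2.2)) + γβ * (α₀ + α₁)) :
    B8Thm8Surviving.Thm8SurvivingAt 1 lam.B₁ lam.B₂ (fun j : IdxB8SubDPerκ θ P Mκ Rκ => zdGF3HP₂Per θ.𝔸 θ.L lam.β lam.len j.1.1.1.1.1.1 P) := by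
  -- constants: `0 < B₀ ≤ B₈`, `2 ≤ 5dLB₀ ≤ 5dLB₈`, `0 ≤ γ₈`, `2γ′B₀ ≤ 5dLB₈`
  have hB₀ : 0 < lam.inp.B₀ := lam.inp.B₀_pos
  have hB₈ : 0 < B₈ := lt_of_lt_of_le hB₀ hB₀8
  have h5 : 0 ≤ 5 * (θ.D : ℝ) * θ.L := by positivity
  have hB8' : 2 ≤ 5 * (θ.D : ℝ) * θ.L * B₈ := hB.trans (mul_le_mul_of_nonneg_left hB₀8 h5)
  have hγ₈0 : 0 ≤ γ₈ := zero_le_one.trans hγ₈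
  have hγB2 : 2 * (γ' * lam.inp.B₀) ≤ 5 * (θ.D : ℝ) * θ.L * B₈ :=
    le_trans (le_add_of_nonneg_left (mul_nonneg h5 hB₀.le)) hγB
  -- PROPOSITION 5 ∃∕! WITH SOURCE in the γ′ letters: the three sourced sockets below member-UNIFORM thresholds (dag-n05-w4)
  obtain ⟨cP5, hcP5, H5⟩ := exists_uniform_threshold_sp5_src_γ' (𝔸 := θ.𝔸) (γ := γ₈) hD θ.two_le_L hB8' hfreeS hcL hB₀ lam.inp.B₀'_pos hB₀'H hB₂' hBG
    hBR hγ₈0 hγ' hB₀8 hγB2 hc59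
  obtain ⟨cPb, hcPb, Hb⟩ := exists_uniform_threshold_sp5base_src_γ' (𝔸 := θ.𝔸) (γ := γ₈) hD θ.two_le_L hfreeS hcL lam.inp.B₀'_pos hB₀'H hB₂' hBG hBR hγ₈0
    hB₈ hB8'
  obtain ⟨cu, cPu, hcu, hcPu, Hu⟩ := exists_uniform_threshold_sp5u_src_γ' (𝔸 := θ.𝔸) (γ := γ₈) hD θ.two_le_L hB8' hcL hB₀ lam.inp.B₀'_pos hB₀'H hB₂' hBG hBR
    hγ₈0 hγ' hB₀8 hγB2 hc59
  -- ONE threshold for Theorem 8's four Prop-5-type sockets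
  have hcP : 0 < min c59 (min cPb (min cP5 cPu)) := lt_min hc59 (lt_min hcPb (lt_min hcP5 hcPu))
  have hP59 : min c59 (min cPb (min cP5 cPu)) ≤ c59 := min_le_left _ _
  have hPb : min c59 (min cPb (min cP5 cPu)) ≤ cPb := (min_le_right _ _).trans (min_le_left _ _)
  have hP5 : min c59 (min cPb (min cP5 cPu)) ≤ cP5 := (min_le_right _ _).trans ((min_le_right _ _).trans (min_le_left _ _))
  have hPu : min c59 (min cPb (min cP5 cPu)) ≤ cPu := (min_le_right _ _).trans ((min_le_right _ _).trans (min_le_right _ _))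
  -- the sockets-displayed theorem at the served sockets (print's class: box law and trichotomy by `ZdIdx.towerBondsP_laws`; tower law from №-laws)
  exact t8P₂DK2Per_of_socketsSrc_γ' lam P Mκ Rκ hD hcP hcu hcP3 hγ₈ hγ' hγ'' hB hB₀β hB₀8 hγB hγB'' hB8β hB₁eq hB₂eq
    (fun i hΩ hl hds hlt hκ α₀ α₁ hα₀ hα₁ hs => Hb i.η i.k i.Ω i.Λs (fun m j => towerBondsP θ.L i.Ω (i.Λs m) j) i.hη i.hk i.hΩ
      hl.toIdxB8Laws.tower_all (SLet i hΩ hl hds hlt hκ) α₀ α₁ hα₀ hα₁ (hs.trans hPb))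
    (fun i hΩ hl hds hlt hκ α₀ α₁ hα₀ hα₁ hs => H5 i.η i.k i.Ω i.Λs (fun m j => towerBondsP θ.L i.Ω (i.Λs m) j) i.hη i.hΩ
      (B8TowerBondsPrinted.ZdIdx.towerBondsP_laws i).1 (B8TowerBondsPrinted.ZdIdx.towerBondsP_laws i).2 hl.toIdxB8Laws.tower_all
      hl.trunc_lt hl.trunc_top (SLet i hΩ hl hds hlt hκ) (SH59src i hΩ hl hds hlt hκ) α₀ α₁ hα₀ hα₁ (hs.trans hP5))
    (fun i hΩ hl hds hlt hκ α₀ α₁ hα₀ hα₁ hs => SH59src i hΩ hl hds hlt hκ α₀ α₁ hα₀ hα₁ (hs.trans hP59))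
    (fun i hΩ hl hds hlt hκ α₀ α₁ hα₀ hα₁ hs => Hu i.η i.k i.Ω i.Λs (fun m j => towerBondsP θ.L i.Ω (i.Λs m) j) i.hη i.hk i.hΩ hΩ
      (B8TowerBondsPrinted.ZdIdx.towerBondsP_laws i).1 (B8TowerBondsPrinted.ZdIdx.towerBondsP_laws i).2 i.htower
      (SLetUB i hΩ hl hds hlt hκ) (SH59src i hΩ hl hds hlt hκ) α₀ α₁ hα₀ hα₁ (hs.trans hPu))
    SB9srcHP

end T8P


end Summit.QuantumFields.YangMills.BalabanUVNodes.N05SubBP2DK2PerT8SrvGammaPrime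

end
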